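/-
Copyright (c) 2026 the pub-hodgecm-mathlib formalisation cell (harness21).  Prover seat hodgecm-mathlib-LH4-p16 (g2), req620 Track A «(D-RAM) FOUR-FRAME» squad
(STAGE-1b, row (2) of the piece `f_{T₊}`, the (β₂) road (R-36); β₂ sub-dealer LH4-p04 (g9) (L-Σ-3C); the ANY-PARITY twin of LH4-p19 (g2)'s (L-D♭) affine-label
dictionary `…DiagonalCellAffineLabel` (d even), for lane C's row (MECH-K1 v1 §2 INTERMEDIATE cells; ★ `…RowVertexAffineCoordinate` HEAD `rayScalar_eq_affine`)), 2026-09-04.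
-/
import Summits.HodgeConjecture.HodgeConjecture.Theorems.F0P3cDyRamLabelShellFlipCardTwo        -- ★ p862206 (LH4-p15 (g0)) §5: `v_refSkew_eq` (`|t₊| = |ϖ|^{d%2}`, ANY parity); brings ★ №3 `mstarOfRecord`
import Literature.NumberTheory.LocalFields.QuadraticOrderIntegralBasis                  -- brings ★ `WildQuadraticEisensteinFrame` (`exists_fixed_coords_of_map_ne`, `v_fixed_add_fixed_mul_eq_max`)
import Summits.HodgeConjecture.HodgeConjecture.Theorems.F0P3cDyRamDiagonalCellAffineLabel      -- ★ (LH4-p19 (g2)): `v_fst_eq_of_fixed_coords` (d-even HEAD `exists_affineLabel_of_coords`); brings ★ `normSign_eq_of_near`, `normSign_mul_of_fixed`, ★ `normSign`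
import HarnessLib

/-!
# Crux `H413`, line LH4 «(D-RAM) FOUR-FRAME» — STAGE-1b, row (2), the (β₂) road (R-36), lane C: «THE AFFINE LABEL, ANY PARITY» — for a scalar `s = T̂·(â + b̂·V)` with
# `|â| = |t₊| = |ϖ|^{d%2}` and `|b̂| = |t₊|·|ϖ|^{2g}` (`g ≥ 1`), the norm sign of any fixed `f` with `|s − f·t₊| ≤ |ϖ|^{m*}` is `ω(f) = ω(T̂)·ω(α₁ + γ₁·V)` with
# `σ`-fixed `α₁` (unit), `γ₁` (`|γ₁| = |ϖ|^{2g}`) — LH4-p19 (g2)'s `exists_affineLabel_of_coords` WITHOUT `d % 2 = 0`, the input of ★ p862655's digit balance in lane C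

Cell `hodgecm-mathlib` (D-0151), FLOOR 0, crux item H413 = `stmt-HodgeConjecture-24833`, route of record `HCCMUnconditional`; squad F0∕P3c∕LH4; lane
`--supports stmt-HodgeConjecture-24833 --as helper` (count-neutral; pays NO tier-0 row).  THEOREMS ONLY (no `def`, no instance, no notation, no `sorry`, default heartbeats);
★-only imports; states NO law; (β₂) stays a HYPOTHESIS.  `E`-side only: a complete sheet datum `IsRamifiedQuadraticDatum σ ϖ d t` with finite residue field, `d` of ANY parity.

WHY (LH4-p19 (g2) 22:55:21Z ★-cand `Theorems/F0P3cDyRamDiagonalCellAffineLabel.lean :: exists_affineLabel_of_coords` is stated for `d` EVEN (`|t₊| = 1`, `|â| = 1`); lane C has places of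
BOTH parities (ℚ₂(√2): `d = 3`, the MECH-K0 keys), and by ★ `…RowVertexAffineCoordinate` HEAD `rayScalar_eq_affine` the ray scalar of every lane-C row vertex is
`e₀′ = pw·(μ_a + μ_b·(R₀ + V·γ₀))` — the shape `T̂(â + b̂V)` with `T̂ = pw·(ϖσϖ)^b` (a fixed UNIT), `â = (μ_a + μ_b R₀)∕(ϖσϖ)^b` (`|â| = |ϖ|^{d%2} = |t₊|` on the row),
`b̂ = μ_b γ₀∕(ϖσϖ)^b`; the vertex letter is `VS_{m*}(e′ • X₊)` for a fixed `e′` with `|e₀′ − e′·t₊| ≤ |ϖ|^{m*}` and its label is `ω(e′)` (★ p861154).)  THIS FILE: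
* (★ LH4-p19 (g2) `…DiagonalCellAffineLabel.v_fst_eq_of_fixed_coords` BY NAME: the leading Eisenstein coefficient of an element of even valuation carries the valuation.)
* HEAD `exists_affineLabel_of_coords_any` — for `|â| = |ϖ|^{d%2}`, `|b̂| = |ϖ|^{2g + d%2}`, `1 ≤ g`: ∃ fixed `α₁` (unit), `γ₁` (`|γ₁| = |ϖ|^{2g}`) — the leading coefficients of `â∕t₊`,
  `b̂∕t₊` — such that for every fixed unit `T̂`, fixed integer `V`, fixed `f` with `|T̂(â + b̂V) − f·t₊| ≤ |ϖ|^{m*}`: `ω(f) = ω(T̂)·ω(α₁ + γ₁V)` (LH4-p19's proof VERBATIM with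
  `|t₊| = |ϖ|^{d%2}` from ★ `v_refSkew_eq`: the near-letter divides to `|ϖ|^{m* − d%2} = |ϖ|^{2d−1}`, exactly ★ `normSign_eq_of_near`'s conductor digit).
WHAT IS NOT CLAIMED: the coordinates (★ `…RowVertexAffineCoordinate`), the digit balance (★ p862655), the fibration ∕ population halving (K5), the near-fixedness of the ray scalar.
HONEST LABEL.  Count-neutral `E`-algebra; nothing printed is asserted; no census law is stated; `HC_CM` is proved only modulo the 7 printed citations (2 remaining named inputs: hLiu418 =
`stmt-HodgeConjecture-24832`, h413 = `stmt-HodgeConjecture-24833`) until rung 0 closes.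
## References
* [Serre1979] J.-P. Serre, *Local Fields*, GTM 67 (1979): Ch. I §6 Prop. 18 (Eisenstein bases), Ch. V §3 Cor. 3 pp. 85–87, Ch. XIV §2–§3 (the norm residue symbol on `U^{(n)}`).
* [Rogawski1990] J. D. Rogawski, Ann. of Math. Stud. 123 (1990): §4.9 Prop. 4.9.1 (b) p. 55; [LanglandsShelstad1987] R. P. Langlands, D. Shelstad, Math. Ann. 278 (1987): §1–§3.
-/

set_option autoImplicit false

noncomputable section

namespace Summit.HodgeConjecture.HodgeConjecture.Cruxes.H413.F0P3cDyRamAffineLabelAnyParity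

open scoped Valued WithZero
open WithZero
open Literature.NumberTheory.Automorphic.UnitaryThreeFourFrame (IsRamifiedQuadraticDatum normSign)
open Literature.NumberTheory.LocalFields (exists_fixed_coords_of_map_ne v_fixed_add_fixed_mul_eq_max)
open Literature.NumberTheory.LocalFields.WildQuadraticDatum (v_varpi_pow even_log_v_of_fixed map_varpi_ne normSign_eq_of_near normSign_mul_of_fixed)
open Summit.HodgeConjecture.HodgeConjecture.Cruxes.H413.F0P3cDyRamFourFramePieces (mstarOfRecord)
open Summit.HodgeConjecture.HodgeConjecture.Cruxes.H413.F0P3cDyRamLabelShellFlipCardTwo (v_refSkew_eq)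
open Summit.HodgeConjecture.HodgeConjecture.Cruxes.H413.F0P3cDyRamDiagonalCellAffineLabel (v_fst_eq_of_fixed_coords)

variable {K : Type} [Field K] [Valued K ℤᵐ⁰] {σ : K →+* K} {ϖ : K} {d t : ℕ}

/-! ## HEAD — the affine label, any parity of `d` (§1 of LH4-p19's file — the leading coefficient — is reused BY NAME) -/

/-- **HEAD — «THE AFFINE LABEL, ANY PARITY».**  At a complete sheet datum `IsRamifiedQuadraticDatum σ ϖ d t` with finite residue field (`d` of ANY parity; `t₊ = (ϖ − σϖ)((ϖσϖ)^{⌊d∕2⌋})⁻¹`,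
`|t₊| = |ϖ|^{d%2}`), for `â, b̂` with `|â| = |ϖ|^{d%2}`, `|b̂| = |ϖ|^{2g + d%2}`, `1 ≤ g`, there are `σ`-FIXED `α₁, γ₁` with `|α₁| = 1`, `|γ₁| = |ϖ|^{2g}` such that for every
`σ`-fixed unit `T̂`, `σ`-fixed integer `V` and `σ`-fixed `f` with `|T̂·(â + b̂·V) − f·t₊| ≤ |ϖ|^{m*}` (`m* = mstarOfRecord d = d%2 + 2d − 1`): **`ω(f) = ω(T̂)·ω(α₁ + γ₁V)`**.
(Lane C: `T̂ = pw·(ϖσϖ)^b`, `â = (μ_a + μ_b R₀)∕(ϖσϖ)^b`, `b̂ = μ_b γ₀∕(ϖσϖ)^b`, `V = V(Λ)` of ★ `…RowVertexAffineCoordinate`.) [cite: Serre1979, Ch. I §6 Prop. 18] [cite: Serre1979, Ch. V §3 Cor. 3 pp. 85–87]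
[cite: Serre1979, Ch. XIV §2–§3] [cite: Rogawski1990, §4.9 Prop. 4.9.1 (b) p. 55] [cite: LanglandsShelstad1987, §1–§3] -/
theorem exists_affineLabel_of_coords_any [CompleteSpace K] [Finite 𝓀[K]] (hD : IsRamifiedQuadraticDatum σ ϖ d t)
    {â bh : K} (hâ : Valued.v â = Valued.v ϖ ^ (d % 2)) {g : ℕ} (hbh : Valued.v bh = Valued.v ϖ ^ (2 * g + d % 2)) (hg1 : 1 ≤ g) :
    ∃ α₁ γ₁ : K, σ α₁ = α₁ ∧ Valued.v α₁ = 1 ∧ σ γ₁ = γ₁ ∧ Valued.v γ₁ = Valued.v ϖ ^ (2 * g) ∧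
      ∀ (T V f : K), σ T = T → Valued.v T = 1 → σ V = V → Valued.v V ≤ 1 → σ f = f →
        Valued.v (T * (â + bh * V) - f * ((ϖ - σ ϖ) * ((ϖ * σ ϖ) ^ ((d - d % 2) / 2))⁻¹)) ≤ Valued.v ϖ ^ mstarOfRecord d →
        normSign σ f = normSign σ T * normSign σ (α₁ + γ₁ * V) := by
  obtain ⟨hσσ, hvσ, hϖ, hfix, hdd, hd1, ht⟩ := id hD
  have hvt : Valued.v ((ϖ - σ ϖ) * ((ϖ * σ ϖ) ^ ((d - d % 2) / 2))⁻¹) = Valued.v ϖ ^ (d % 2) := v_refSkew_eq hvσ hϖ hdd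
  have hσt : σ ((ϖ - σ ϖ) * ((ϖ * σ ϖ) ^ ((d - d % 2) / 2))⁻¹) = -((ϖ - σ ϖ) * ((ϖ * σ ϖ) ^ ((d - d % 2) / 2))⁻¹) := by
    rw [map_mul, map_inv₀, map_pow, map_mul, map_sub, hσσ, mul_comm (σ ϖ) ϖ]; ring
  have hfix' : ∀ c : K, σ c = c → c ≠ 0 → Even (log (Valued.v c)) := fun c hc hc0 => even_log_v_of_fixed hfix c hc hc0
  have hvϖ0 : Valued.v ϖ ≠ 0 := by rw [hϖ]; exact exp_ne_zero
  have hϖlt : Valued.v ϖ < 1 := by rw [hϖ, ← exp_zero, exp_lt_exp]; norm_num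
  have hϖ1 : Valued.v ϖ ≤ 1 := hϖlt.le
  have hϖσ : σ ϖ ≠ ϖ := map_varpi_ne hϖ hdd
  set tp : K := (ϖ - σ ϖ) * ((ϖ * σ ϖ) ^ ((d - d % 2) / 2))⁻¹ with htp
  have hvt0 : Valued.v tp ≠ 0 := by rw [hvt]; exact pow_ne_zero _ hvϖ0
  have htp0 : tp ≠ 0 := (Valuation.ne_zero_iff _).1 hvt0
  -- Eisenstein coordinates of `â/t₊` (a unit) and `b̂/t₊` (valuation `2g`)
  obtain ⟨α₁, y₁, hα₁, hy₁, hα⟩ := exists_fixed_coords_of_map_ne hσσ hϖσ (â / tp)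
  obtain ⟨γ₁, y₂, hγ₁, hy₂, hγ⟩ := exists_fixed_coords_of_map_ne hσσ hϖσ (bh / tp)
  have hα1 : Valued.v α₁ = 1 := by
    have h := v_fst_eq_of_fixed_coords hD hα₁ hy₁ (n := 0) (by rw [← hα, map_div₀, hâ, hvt, div_self (pow_ne_zero _ hvϖ0)]; norm_num)
    rw [h]; norm_num
  have hγ1 : Valued.v γ₁ = Valued.v ϖ ^ (2 * g) := by
    have h := v_fst_eq_of_fixed_coords hD hγ₁ hy₂ (n := -(g : ℤ))
      (by rw [← hγ, map_div₀, hbh, hvt, pow_add, mul_div_cancel_right₀ _ (pow_ne_zero _ hvϖ0), v_varpi_pow hϖ]; push_cast; ring_nf)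
    rw [h, v_varpi_pow hϖ]; push_cast; ring_nf
  refine ⟨α₁, γ₁, hα₁, hα1, hγ₁, hγ1, fun T V f hσT hT1 hσV hV1 hσf hsf => ?_⟩
  have hT0 : T ≠ 0 := fun h0 => by rw [h0, map_zero] at hT1; exact zero_ne_one hT1
  -- the affine part `f₀` and the tail `Y`
  set f₀ : K := T * (α₁ + γ₁ * V) with hf₀
  set Y : K := T * (y₁ + y₂ * V) with hY
  have hσf₀ : σ f₀ = f₀ := by rw [hf₀, map_mul, map_add, map_mul, hσT, hα₁, hγ₁, hσV]
  have hσY : σ Y = Y := by rw [hY, map_mul, map_add, map_mul, hσT, hy₁, hy₂, hσV]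
  have hdec : T * (â + bh * V) / tp = f₀ + Y * ϖ := by
    have e1 : â = (α₁ + y₁ * ϖ) * tp := by rw [← hα, div_mul_cancel₀ â htp0]
    have e2 : bh = (γ₁ + y₂ * ϖ) * tp := by rw [← hγ, div_mul_cancel₀ bh htp0]
    rw [e1, e2, hf₀, hY]; field_simp; ring
  -- `|f₀| = 1`
  have hγlt : Valued.v (γ₁ * V) < Valued.v α₁ := by
    rw [hα1, Valuation.map_mul, hγ1]
    calc Valued.v ϖ ^ (2 * g) * Valued.v V ≤ Valued.v ϖ ^ (2 * g) * 1 := by gcongr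
      _ < 1 := by rw [mul_one]; exact pow_lt_one₀ zero_le hϖlt (by omega)
  have hf₀1 : Valued.v f₀ = 1 := by rw [hf₀, Valuation.map_mul, hT1, one_mul, Valuation.map_add_eq_of_lt_left _ hγlt, hα1]
  -- `|f₀ − f| ≤ |ϖ|^{2d−1}` (the near-letter divided by `|t₊| = |ϖ|^{d%2}`)
  have hnear : Valued.v (f₀ - f) ≤ Valued.v ϖ ^ (2 * d - 1) := by
    have h1 : Valued.v (T * (â + bh * V) / tp - f) ≤ Valued.v ϖ ^ (2 * d - 1) := by
      have e : T * (â + bh * V) / tp - f = (T * (â + bh * V) - f * tp) / tp := by field_simp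
      rw [e, map_div₀, hvt, div_le_iff₀ (zero_lt_iff.2 (pow_ne_zero _ hvϖ0)), ← pow_add]
      refine hsf.trans (le_of_eq ?_)
      simp only [mstarOfRecord]; congr 1; omega
    rw [hdec] at h1
    have e2 : f₀ + Y * ϖ - f = (f₀ - f) + Y * ϖ := by ring
    rw [e2, v_fixed_add_fixed_mul_eq_max hfix' hϖ (by rw [map_sub, hσf₀, hσf]) hσY] at h1
    exact (le_max_left _ _).trans h1
  rw [normSign_eq_of_near hD hσf₀ hσf hf₀1 (n := 2 * d - 1) le_rfl hnear, hf₀]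
  have hαV0 : α₁ + γ₁ * V ≠ 0 := fun h0 => by
    have : Valued.v (α₁ + γ₁ * V) = 1 := by rw [Valuation.map_add_eq_of_lt_left _ hγlt, hα1]
    rw [h0, map_zero] at this; exact zero_ne_one this
  exact normSign_mul_of_fixed hD hσT (by rw [map_add, map_mul, hα₁, hγ₁, hσV]) hT0 hαV0

end Summit.HodgeConjecture.HodgeConjecture.Cruxes.H413.F0P3cDyRamAffineLabelAnyParity

end
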